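import Summits.BirchSwinnertonDyer.BirchSwinnertonDyer.Theorems.PrintCf2SplitBadEisensteinTwoHalvesOfKSide
import Summits.BirchSwinnertonDyer.Rank1Residual.AdditivePotMult.QuadraticBaseChangeThetaModel
import Literature.NumberTheory.DiophantineGeometry.MinimalDiscriminantNormProofs
import Literature.NumberTheory.DiophantineGeometry.MinimalDiscriminantSmulProofs
import Literature.NumberTheory.DiophantineGeometry.EllArithGlue
import Literature.NumberTheory.EllipticCurves.HeegnerHypothesisKroneckerProofs
import HarnessLib

/-!
# Child crux `PrintCf2.SplitBadTwoUpperHalfOfFacts` (item 27850), line `kside_finite_two` — support B1′: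
# the INDEX-currency Kolyvagin bound on Heegner frames ⟹ the `Ш_an`-currency `K`-side upper half (stub U′'s text)

Cell `bsd-print-cf2`, seat `bsd-line-cf2-p1-w4` g3 (EXTRA WIDTH seat on crux stmt-BirchSwinnertonDyer-20368; no lead live).
`--supports stmt-BirchSwinnertonDyer-27850` (helper B1′ of the line card `Lines/kside-finite-two.md`). Theses-free; THEOREMS ONLY
(0 definitions, 0 named facts, 0 `sorry`); CONDITIONAL on every displayed hypothesis. BSD is proved for no curve by any of this; no summit
statement is proved by this seat.

WHAT. The registered research stub `stub_kolyvaginUpperOverKAtTwo` of child 27850 is stated in `Ш_an` currency: for `W` in the class, every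
Heegner field `K` of `N_W` with `L(E^{(d_K)},1) ≠ 0` and every globally minimal `K`-model `W'` of `E_K`, `#Ш_an(W')` is a rational `q'` with
`ord₂ #Ш(W') ≤ ord₂ q'`. Kolyvagin's METHOD speaks index currency: on a Heegner frame `(N, K, Dt, H, ι, P)` with `d_K < −4`, `P` non-torsion,
`Ш(E/K)` finite, `ord₂ #Ш(E/K)[2^∞] + ord₂ c_K ≤ 2·ord₂ [E(K):ℤP] − 2·ord₂ c_Manin` (planner sketch `KolyvaginBoundAtTwoOnFrames`, HOME
`bsd-print-cf2-plan/Lines/kolyvagin-finite-sketch.lean`). This file proves, for ONE `W/ℚ` with `r_an(W) = 1` and `2 ∣ N_W` (no CM needed),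
INDEX bound on all frames ⟹ `Ш_an` bound at all Heegner fields / minimal models — so the planner may re-cut U′ to the index currency.

* §1 `exists_units_eq_u_of_isGloballyMinimal`, `shaAnOver_eq_of_isGloballyMinimal`, `shaOrder_eq_of_smul_eq` — two globally minimal
  `K`-models of one curve differ by `u ∈ 𝓞_K^×` (Silverman VII.1.3(b) placewise + `𝓞_K = ⋂ O_v`), hence have the same `#Ш_an` and `#Ш`.
* §2 `upperOverK_baseChange_of_indexBound_two` — ONE frame: Gross–Zagier's exact value `#Ш_an(E_K) = 4I²/(c²w²c_K)` (`w_K = 2` as `d_K < −4`)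
  turns the index inequality into `ord₂ #Ш(E_K) ≤ ord₂ #Ш_an(E_K)`.
* §3 `upperOverK_of_kolyvaginBoundOnFrames` — B1′: toric prints (GZ, Kolyvagin, modularity, Heegner points) + `r_an(W) = 1` + `2 ∣ N_W` +
  the index bound on every frame ⟹ the text of `stub_kolyvaginUpperOverKAtTwo` for this `W` (the `hKup` binder of
  `EisensteinTwo.missingUpperBoundAt_two_of_upperOverK_of_twist`, p636912); `upperOverK_of_kolyvaginBoundOnFrames_of_not_good` — the class form.

References: [Kolyvagin1990] Thm. A (shape); [GrossZagier1986] Thm. I.6.3, V.(2.2); [SilvermanAEC2009] VII.1 Prop. 1.3(b), VIII.8;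
[Miller2011LMS] Def. 1.1.
-/

set_option autoImplicit false

-- D-0017 layout: summit = sub-problem, so `Summit.BirchSwinnertonDyer.BirchSwinnertonDyer.…` is the mandated namespace of Theorems files.
set_option linter.dupNamespace false

noncomputable section

open scoped Classical NumberField

namespace Summit.BirchSwinnertonDyer.BirchSwinnertonDyer.Theorems.PrintCf2.KsideFiniteTwo

open WeierstrassCurve NumberField IsDedekindDomain
  Literature.NumberTheory.EllipticCurves Literature.NumberTheory.EllipticCurves.ModularForms
  Literature.NumberTheory.EllipticCurves.Rank1Residual Literature.NumberTheory.EllipticCurves.Rank1Residual.Typed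
  Literature.NumberTheory.EllipticCurves.KrizLi2019
  Summit.BirchSwinnertonDyer.Rank1Residual Summit.BirchSwinnertonDyer.Rank1Residual.AdditivePotMult
  Summit.BirchSwinnertonDyer.BirchSwinnertonDyer.Theses.UniversalToricDescent

/-! ### §1 Two globally minimal `K`-models differ by a unit of `𝓞_K` -/

section Models

variable {K : Type} [Field K] [NumberField K]
  (V : WeierstrassCurve K) [V.IsElliptic] [V.IsGloballyMinimal]
  (W' : WeierstrassCurve K) [W'.IsElliptic] [W'.IsGloballyMinimal]

/-- **Two globally minimal Weierstrass models over a number field differ by a unit.** If `V` and `W' = C • V` are both globally minimal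
models of an elliptic curve over `K`, then the scaling `u` of `C` lies in `𝓞_K^×`: at every finite place both equations are minimal, so
`ord_v Δ(W') = ord_v Δ_min = ord_v Δ(V)` (`valuation_Δ_eq_of_isMinimalAt_holds`, `ordMinimalDiscriminant_smul_holds`) while `Δ(W') = u⁻¹² Δ(V)`,
whence `v(u) = 1` for all `v` and `u`, `u⁻¹` are algebraic integers (`mem_integers_of_valuation_le_one`).
[cite: SilvermanAEC2009, VII.1 Prop. 1.3(b) and VIII.8 (definition of a global minimal equation)] -/
theorem exists_units_eq_u_of_isGloballyMinimal (C : VariableChange K) (hC : C • V = W') :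
    ∃ x : (𝓞 K)ˣ, ((x : 𝓞 K) : K) = (C.u : K) := by
  have hΔ : V.Δ ≠ 0 := V.Δ'.ne_zero
  have hval : ∀ v : HeightOneSpectrum (𝓞 K), v.valuation K (C.u : K) = 1 := by
    intro v
    have h1 := valuation_Δ_eq_of_isMinimalAt_holds (v := v) (W := V) (IsGloballyMinimal.isMinimalAt V v)
    have h2 := valuation_Δ_eq_of_isMinimalAt_holds (v := v) (W := W') (IsGloballyMinimal.isMinimalAt W' v)
    have h3 : W'.ordMinimalDiscriminant v = V.ordMinimalDiscriminant v := by
      rw [← hC]; exact ordMinimalDiscriminant_smul_holds v V C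
    rw [h3, ← h1, ← hC, variableChange_Δ, map_mul, map_pow, mul_left_eq_self₀] at h2
    rcases h2 with h2 | h2
    · rw [pow_eq_one_iff_left (by norm_num), Units.val_inv_eq_inv_val, map_inv₀, inv_eq_one] at h2
      exact h2
    · exact absurd ((map_eq_zero _).mp h2) hΔ
  have hu0 : (C.u : K) ≠ 0 := C.u.ne_zero
  obtain ⟨e, he⟩ := HeightOneSpectrum.mem_integers_of_valuation_le_one (R := 𝓞 K) K (C.u : K) fun v => (hval v).le
  obtain ⟨e', he'⟩ := HeightOneSpectrum.mem_integers_of_valuation_le_one (R := 𝓞 K) K (C.u : K)⁻¹ fun v => by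
    rw [map_inv₀, hval v, inv_one]
  have hee' : e * e' = 1 := by
    apply IsFractionRing.injective (𝓞 K) K
    rw [map_mul, map_one, he, he', mul_inv_cancel₀ hu0]
  exact ⟨⟨e, e', hee', by rw [mul_comm]; exact hee'⟩, he⟩

/-- **`#Ш_an` does not depend on the globally minimal model.** For `W' = C • V` with both models globally minimal: leading coefficient,
torsion, regulator and Tamagawa product are model invariants and the BSD period is unchanged for `u ∈ 𝓞_K^×`
(`bsdPeriod_smul_of_isUnit'`), so `shaAnOver W' = shaAnOver V`. [cite: SilvermanAEC2009, VII.1 Prop. 1.3(b)] [cite: Miller2011LMS, Def. 1.1] -/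
theorem shaAnOver_eq_of_isGloballyMinimal (C : VariableChange K) (hC : C • V = W') : shaAnOver W' = shaAnOver V := by
  obtain ⟨x, hx⟩ := exists_units_eq_u_of_isGloballyMinimal V W' C hC
  subst hC
  rw [shaAnOver, shaAnOver, leadingLCoeff_smul V C, torsionOrder_variableChange_holds V C, regulator_variableChange_holds V C,
    tamagawaProduct_variableChange_eq V C, V.bsdPeriod_smul_of_isUnit' C x hx]

omit [V.IsElliptic] [V.IsGloballyMinimal] [W'.IsElliptic] [W'.IsGloballyMinimal] in
/-- `#Ш` is a model invariant (`shaOrder_variableChange`). [folklore] -/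
theorem shaOrder_eq_of_smul_eq (C : VariableChange K) (hC : C • V = W') : W'.shaOrder = V.shaOrder := by
  subst hC; exact shaOrder_variableChange_holds V C

end Models

/-! ### §2 One frame: the index bound ⟹ the `Ш_an`-currency upper half on `E_K` -/

/-- **Index bound ⟹ `ord₂ #Ш(E_K) ≤ ord₂ #Ш_an(E_K)` on ONE Heegner frame.** `W/ℚ` elliptic, `K` imaginary quadratic with the Heegner
hypothesis for `N = N_W` and `d_K < −4`, `(Dt, H, ι, P)` a Heegner frame, `(W ⊗ K)` of analytic rank `1`; GIVEN Gross–Zagier `hGZ`, Kolyvagin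
`hKo`, modularity `hmod` (the exact value `#Ш_an(E_K) = 4I²/(c²w²c_K)`, `shaAnOver_baseChange_eq_heegnerIndex_sq`, with `w_K = 2`) and the
INDEX inequality `ord₂ #Ш(E/K)[2^∞] + ord₂ c_K ≤ 2·ord₂ I − 2·ord₂ c`: THEN `#Ш_an(E_K)` is a rational `q'` with `ord₂ #Ш(E_K) ≤ ord₂ q'`.
Pure valuation bookkeeping (as in `EisensteinTwo.upperOver_of_upperDivisibility_two`). [cite: GrossZagier1986, Thm. I.6.3 and V.(2.2)]
[cite: Kolyvagin1990, Thm. A (shape)] -/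
theorem upperOverK_baseChange_of_indexBound_two
    (W : WeierstrassCurve ℚ) [W.IsElliptic] {N : ℕ} [NeZero N] (K : Type) [Field K] [NumberField K]
    (Dt : ModularParametrizationData W N) (H : HeegnerDatum N (NumberField.discr K)) (ι : K →+* ℂ)
    (P : (W.baseChange K).toAffine.Point)
    (hGZ : gross_zagier N W K) (hKo : kolyvagin N W K) (hmod : hasEntireLFunction_rat)
    (hK : IsImaginaryQuadratic K) (hd4 : NumberField.discr K < -4) (hHN : SatisfiesHeegnerHypothesis N K)
    (hP : WeierstrassCurve.Affine.Point.map ι.toRatAlgHom P = heegnerPointComplex Dt H)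
    (hrK : (W.baseChange K).analyticRank = 1)
    (hbound : (padicValNat 2 (Nat.card (AddCommGroup.primaryComponent (W.baseChange K).sha 2)) : ℤ) +
        (padicValNat 2 (W.baseChange K).tamagawaProduct : ℤ) ≤
      2 * (padicValNat 2 (AddSubgroup.zmultiples P).index : ℤ) - 2 * (padicValNat 2 Dt.c.natAbs : ℤ)) :
    ∃ q' : ℚ, shaAnOver (W.baseChange K) = (q' : ℂ) ∧
      (padicValNat 2 (W.baseChange K).shaOrder : ℤ) ≤ padicValRat 2 q' := by
  have hc0 : Dt.c ≠ 0 := Dt.maninConstant_ne_zero_holds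
  obtain ⟨hrk, hShaK, hval⟩ := Summit.BirchSwinnertonDyer.Rank1Residual.P2.shaAnOver_baseChange_eq_heegnerIndex_sq W N K Dt H ι P
    hGZ hKo hmod hK hHN hP hc0 hrK
  haveI : Finite (W.baseChange K).sha := hShaK
  refine ⟨_, hval, ?_⟩
  set I : ℕ := (AddSubgroup.zmultiples P).index with hI_def
  have hw2 : Units.torsionOrder K = 2 :=
    Literature.NumberTheory.QuadraticFields.Quadratic.torsionOrder_eq_two_of_discr_lt_neg_four hK.1 hd4
  -- `P` is non-torsion: `I ≠ 0` is read off the height identity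
  have hPinf : ¬ IsOfFinAddOrder P := by
    intro hfin
    have hLK := (lDerivEK_ne_zero_iff_not_isOfFinAddOrder W N K hGZ hK hHN ⟨Dt, H, ι, hP⟩).not
    obtain ⟨-, hLK'⟩ := Summit.BirchSwinnertonDyer.Rank1Residual.P2.leadingLCoeff_baseChange_eq_lDerivEK W K hmod hK.1 hrK
    exact (hLK.mpr (not_not.mpr hfin)) hLK'
  have hheight := Summit.BirchSwinnertonDyer.Rank1Residual.P2.torsionOrder_sq_mul_canonicalHeight_eq_index_sq_mul_regulator
    (W.baseChange K) hrk P hPinf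
  have htK : 0 < (W.baseChange K).torsionOrder := (W.baseChange K).torsionOrder_pos_holds
  have hI0 : I ≠ 0 := by
    intro hI
    rw [← hI_def, hI] at hheight
    have h0 : ((W.baseChange K).torsionOrder : ℝ) ^ 2 * P.canonicalHeight = 0 := by rw [hheight]; simp
    rcases mul_eq_zero.mp h0 with h' | h'
    · exact absurd ((pow_eq_zero_iff two_ne_zero).mp h') (by exact_mod_cast htK.ne')
    · exact hPinf ((Affine.Point.canonicalHeight_eq_zero_iff_holds P).mp h')
  have hcK : 0 < (W.baseChange K).tamagawaProduct := (W.baseChange K).tamagawaProduct_pos_holds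
  have hIQ : (I : ℚ) ≠ 0 := by exact_mod_cast hI0
  have hcQ : (Dt.c : ℚ) ≠ 0 := by exact_mod_cast hc0
  have hwQ : (Units.torsionOrder K : ℚ) ≠ 0 := by rw [hw2]; norm_num
  have hcKQ : ((W.baseChange K).tamagawaProduct : ℚ) ≠ 0 := by exact_mod_cast hcK.ne'
  have hsha : padicValNat 2 (Nat.card (AddCommGroup.primaryComponent (W.baseChange K).sha 2)) =
      padicValNat 2 (W.baseChange K).shaOrder :=
    Literature.NumberTheory.EllipticCurves.padicValNat_card_addPrimaryComponent 2
  have hcval : padicValRat 2 (Dt.c : ℚ) = (padicValNat 2 Dt.c.natAbs : ℤ) := by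
    rw [padicValRat.of_int]; rfl
  have h2val : padicValRat 2 (((2 : ℕ) : ℚ)) = 1 := by
    rw [padicValRat.of_nat, padicValNat_self]; rfl
  have h4val : padicValRat 2 (4 : ℚ) = 2 := by
    rw [show (4 : ℚ) = ((2 : ℕ) : ℚ) ^ 2 by norm_num, padicValRat.pow, h2val]; norm_num
  have hLHS : padicValRat 2 (4 * (I : ℚ) ^ 2 / ((Dt.c : ℚ) ^ 2 * (Units.torsionOrder K : ℚ) ^ 2 *
      ((W.baseChange K).tamagawaProduct : ℚ))) =
      2 + 2 * (padicValNat 2 I : ℤ) - (2 * (padicValNat 2 Dt.c.natAbs : ℤ) + 2 * 1 +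
        (padicValNat 2 (W.baseChange K).tamagawaProduct : ℤ)) := by
    rw [padicValRat.div (mul_ne_zero (by norm_num) (pow_ne_zero 2 hIQ))
        (mul_ne_zero (mul_ne_zero (pow_ne_zero 2 hcQ) (pow_ne_zero 2 hwQ)) hcKQ),
      padicValRat.mul (by norm_num) (pow_ne_zero 2 hIQ), padicValRat.mul (mul_ne_zero (pow_ne_zero 2 hcQ) (pow_ne_zero 2 hwQ)) hcKQ,
      padicValRat.mul (pow_ne_zero 2 hcQ) (pow_ne_zero 2 hwQ), padicValRat.pow, padicValRat.pow, padicValRat.pow, h4val, hw2, hcval,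
      h2val, padicValRat.of_nat, padicValRat.of_nat]
    push_cast
    ring
  rw [hLHS, ← hsha]
  linarith

/-! ### §3 B1′: the index-currency Kolyvagin bound on every frame ⟹ the stub text of `stub_kolyvaginUpperOverKAtTwo` for `W` -/

/-- **B1′ (generic form).** ONE elliptic, globally minimal `W/ℚ` with `r_an(W) = 1` and `2 ∣ N_W`; GIVEN the toric published inputs `hF`
(used: Gross–Zagier, Kolyvagin, modularity, Heegner points exist) and the INDEX-currency Kolyvagin bound `hKB` on every Heegner frame
`(N, K, Dt, H, ι, P)` of `W` with `d_K < −4`, `P` non-torsion, `Ш(E/K)` finite (`KolyvaginBoundAtTwoOnFrames W` of the planner sketch,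
unfolded) — THEN the `Ш_an`-currency `K`-side upper half: at every Heegner field `K` of `N_W` with `L(E^{(d_K)},1) ≠ 0` and every globally
minimal `K`-model `W'` of `E_K`, `#Ш_an(W')` is a rational `q'` with `ord₂ #Ш(W') ≤ ord₂ q'` (the `hKup` binder of
`EisensteinTwo.missingUpperBoundAt_two_of_upperOverK_of_twist`). Route: `2 ∣ N_W` and the Heegner hypothesis give `d_K ≡ 1 (8)`, so
`d_K < −4`; a Heegner point `P` exists (`hF`) and is non-torsion since `L'(E/K,1) = L'(E,1)·L(E^{(d_K)},1) ≠ 0` (Gross–Zagier); Kolyvagin gives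
`Ш(E/K)` finite; `hKB` on this frame, §2 on `E_K`, §1 to pass to `W'`. [cite: Kolyvagin1990, Thm. A (shape)]
[cite: GrossZagier1986, Thm. I.6.3 and V.(2.2)] [cite: SilvermanAEC2009, VII.1 Prop. 1.3(b)] -/
theorem upperOverK_of_kolyvaginBoundOnFrames (hF : ToricPublishedInputs)
    (W : WeierstrassCurve ℚ) [W.IsElliptic] [W.IsGloballyMinimal] (hr : W.analyticRank = 1) (h2N : 2 ∣ W.conductorNorm ℤ)
    (hKB : ∀ (N : ℕ) [NeZero N] (K : Type) [Field K] [NumberField K] (Dt : ModularParametrizationData W N)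
      (H : HeegnerDatum N (NumberField.discr K)) (ι : K →+* ℂ) (P : (W.baseChange K).toAffine.Point),
      W.conductorNorm ℤ = N → IsImaginaryQuadratic K → SatisfiesHeegnerHypothesis N K → NumberField.discr K < -4 →
      WeierstrassCurve.Affine.Point.map ι.toRatAlgHom P = heegnerPointComplex Dt H → ¬ IsOfFinAddOrder P →
      Finite (W.baseChange K).sha →
      (padicValNat 2 (Nat.card (AddCommGroup.primaryComponent (W.baseChange K).sha 2)) : ℤ) +
          (padicValNat 2 (W.baseChange K).tamagawaProduct : ℤ) ≤
        2 * (padicValNat 2 (AddSubgroup.zmultiples P).index : ℤ) - 2 * (padicValNat 2 Dt.c.natAbs : ℤ)) :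
    ∀ (N : ℕ) [NeZero N] (K : Type) [Field K] [NumberField K]
      (W' : WeierstrassCurve K) [W'.IsElliptic] [W'.IsGloballyMinimal],
      W.conductorNorm ℤ = N → IsImaginaryQuadratic K → SatisfiesHeegnerHypothesis N K →
      (W.quadraticTwist (NumberField.discr K : ℚ)).entireLFunction 1 ≠ 0 →
      (∃ C : VariableChange K, C • W.baseChange K = W') →
      ∃ q' : ℚ, shaAnOver W' = (q' : ℂ) ∧ (padicValNat 2 W'.shaOrder : ℤ) ≤ padicValRat 2 q' := by
  intro N _ K _ _ W' _ _ hN hK hHN hLt hW'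
  obtain ⟨hGZ, hKo, -, hmod, -, -, -, -, -, hHP⟩ := hF
  subst hN
  ------------------------------------------------------------------ `d_K < −4` from `2 ∣ N_W` and the Heegner hypothesis
  have h2 : Module.finrank ℚ K = 2 := hK.1
  have h8 : NumberField.discr K % 8 = 1 := Literature.SatisfiesHeegnerHypothesis.discr_emod_eight h2 hHN h2N
  have hd4 : NumberField.discr K < -4 := by
    have hneg : NumberField.discr K < 0 := hK.discr_neg
    omega
  ------------------------------------------------------------------ the Heegner point, non-torsion, Kolyvagin
  obtain ⟨P, Dt, H, ι, hP⟩ := hHP W K hK hHN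
  have hL0 : W.entireLFunction 1 = 0 := entireLFunction_one_eq_zero_of_analyticRank_eq_one hr
  obtain ⟨-, hderiv⟩ := leadingLCoeff_eq_deriv_of_analyticRank_eq_one hr
  have hLK : LDerivEK W K ≠ 0 := by
    rw [lDerivEK_eq_deriv_mul W K hmod hL0]; exact mul_ne_zero hderiv hLt
  have hnt : ¬ IsOfFinAddOrder P :=
    (lDerivEK_ne_zero_iff_not_isOfFinAddOrder W (W.conductorNorm ℤ) K (hGZ _ W K) hK hHN ⟨Dt, H, ι, hP⟩).mp hLK
  have hKoK : Literature.NumberTheory.EllipticCurves.kolyvagin (W.conductorNorm ℤ) W K := hKo _ W K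
  obtain ⟨-, hfinK⟩ := hKoK hK hHN ⟨Dt, H, ι, hP⟩ hnt
  haveI hfin : Finite (W.baseChange K).sha := hfinK
  ------------------------------------------------------------------ analytic rank of `E_K`
  have hD0 : (NumberField.discr K : ℚ) ≠ 0 := by exact_mod_cast NumberField.discr_ne_zero K
  haveI hEt : (W.quadraticTwist (NumberField.discr K : ℚ)).IsElliptic := W.isElliptic_quadraticTwist hD0
  have hrd0 : (W.quadraticTwist (NumberField.discr K : ℚ)).analyticRank = 0 :=
    ((W.quadraticTwist (NumberField.discr K : ℚ)).analyticRank_eq_zero_iff_holds (hmod _)).mpr hLt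
  have hrK : (W.baseChange K).analyticRank = 1 :=
    (Summit.BirchSwinnertonDyer.Rank1Residual.P2.analyticRank_baseChange_eq_one_iff W K hmod h2).mpr (Or.inl ⟨hr, hrd0⟩)
  ------------------------------------------------------------------ the frame bound, §2 on `E_K`, §1 to the model `W'`
  have hb := hKB (W.conductorNorm ℤ) K Dt H ι P rfl hK hHN hd4 hP hnt hfin
  obtain ⟨q', hq', hle⟩ := upperOverK_baseChange_of_indexBound_two W K Dt H ι P (hGZ _ W K) hKoK hmod hK hd4 hHN hP hrK hb
  haveI : (W.baseChange K).IsGloballyMinimal := W.isGloballyMinimal_baseChange_of_satisfiesHeegnerHypothesis K h2 hHN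
  haveI : (W.baseChange K).IsElliptic := isElliptic_baseChange' W K
  obtain ⟨C, hC⟩ := hW'
  refine ⟨q', ?_, ?_⟩
  · rw [shaAnOver_eq_of_isGloballyMinimal (W.baseChange K) W' C hC, hq']
  · rw [shaOrder_eq_of_smul_eq (W.baseChange K) W' C hC]; exact hle

/-- **B1′ (class form, the line card's signature).** For `W` with `r_an(W) = 1` and bad reduction at `2` (`¬ Good W 2`, so `2 ∣ N_W`), the
index-currency bound on frames (`KolyvaginBoundAtTwoOnFrames W`, unfolded) gives the text of `stub_kolyvaginUpperOverKAtTwo` for `W`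
(CM and `CMSplit` are not needed for this implication). [cite: Kolyvagin1990, Thm. A (shape)] [cite: GrossZagier1986, V.(2.2)] -/
theorem upperOverK_of_kolyvaginBoundOnFrames_of_not_good (hF : ToricPublishedInputs)
    (W : WeierstrassCurve ℚ) [W.IsElliptic] [W.IsGloballyMinimal] (hr : W.analyticRank = 1) (hng : ¬ Good W 2)
    (hKB : ∀ (N : ℕ) [NeZero N] (K : Type) [Field K] [NumberField K] (Dt : ModularParametrizationData W N)
      (H : HeegnerDatum N (NumberField.discr K)) (ι : K →+* ℂ) (P : (W.baseChange K).toAffine.Point),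
      W.conductorNorm ℤ = N → IsImaginaryQuadratic K → SatisfiesHeegnerHypothesis N K → NumberField.discr K < -4 →
      WeierstrassCurve.Affine.Point.map ι.toRatAlgHom P = heegnerPointComplex Dt H → ¬ IsOfFinAddOrder P →
      Finite (W.baseChange K).sha →
      (padicValNat 2 (Nat.card (AddCommGroup.primaryComponent (W.baseChange K).sha 2)) : ℤ) +
          (padicValNat 2 (W.baseChange K).tamagawaProduct : ℤ) ≤
        2 * (padicValNat 2 (AddSubgroup.zmultiples P).index : ℤ) - 2 * (padicValNat 2 Dt.c.natAbs : ℤ)) :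
    ∀ (N : ℕ) [NeZero N] (K : Type) [Field K] [NumberField K]
      (W' : WeierstrassCurve K) [W'.IsElliptic] [W'.IsGloballyMinimal],
      W.conductorNorm ℤ = N → IsImaginaryQuadratic K → SatisfiesHeegnerHypothesis N K →
      (W.quadraticTwist (NumberField.discr K : ℚ)).entireLFunction 1 ≠ 0 →
      (∃ C : VariableChange K, C • W.baseChange K = W') →
      ∃ q' : ℚ, shaAnOver W' = (q' : ℂ) ∧ (padicValNat 2 W'.shaOrder : ℤ) ≤ padicValRat 2 q' :=
  upperOverK_of_kolyvaginBoundOnFrames hF W hr ((W.dvd_conductorNorm_iff_not_hasGoodReductionAtPrime 2).mpr hng) hKB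

/-! ### §4 The converse: the `Ш_an`-currency upper half ⟹ the index bound on every frame (currency EQUIVALENCE for `W`) -/

/-- **`ord₂ #Ш(E_K) ≤ ord₂ #Ш_an(E_K)` ⟹ the index bound, on ONE Heegner frame** (converse of `upperOverK_baseChange_of_indexBound_two`).
Same frame data (`d_K < −4`, `r_an(E_K) = 1`, Gross–Zagier `hGZ`, Kolyvagin `hKo`, modularity `hmod`): if `#Ш_an(E_K)` is a rational `q'` with
`ord₂ #Ш(E_K) ≤ ord₂ q'`, then `ord₂ #Ш(E/K)[2^∞] + ord₂ c_K ≤ 2·ord₂ [E(K):ℤP] − 2·ord₂ c` — the exact value `q' = 4I²/(c²w²c_K)`, `w_K = 2`, read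
backwards. [cite: GrossZagier1986, Thm. I.6.3 and V.(2.2)] [cite: Kolyvagin1990, Thm. A (shape)] -/
theorem indexBound_two_of_upperOverK_baseChange
    (W : WeierstrassCurve ℚ) [W.IsElliptic] {N : ℕ} [NeZero N] (K : Type) [Field K] [NumberField K]
    (Dt : ModularParametrizationData W N) (H : HeegnerDatum N (NumberField.discr K)) (ι : K →+* ℂ)
    (P : (W.baseChange K).toAffine.Point)
    (hGZ : gross_zagier N W K) (hKo : kolyvagin N W K) (hmod : hasEntireLFunction_rat)
    (hK : IsImaginaryQuadratic K) (hd4 : NumberField.discr K < -4) (hHN : SatisfiesHeegnerHypothesis N K)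
    (hP : WeierstrassCurve.Affine.Point.map ι.toRatAlgHom P = heegnerPointComplex Dt H)
    (hrK : (W.baseChange K).analyticRank = 1)
    (hKup : ∃ q' : ℚ, shaAnOver (W.baseChange K) = (q' : ℂ) ∧ (padicValNat 2 (W.baseChange K).shaOrder : ℤ) ≤ padicValRat 2 q') :
    (padicValNat 2 (Nat.card (AddCommGroup.primaryComponent (W.baseChange K).sha 2)) : ℤ) +
        (padicValNat 2 (W.baseChange K).tamagawaProduct : ℤ) ≤
      2 * (padicValNat 2 (AddSubgroup.zmultiples P).index : ℤ) - 2 * (padicValNat 2 Dt.c.natAbs : ℤ) := by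
  have hc0 : Dt.c ≠ 0 := Dt.maninConstant_ne_zero_holds
  obtain ⟨hrk, hShaK, hval⟩ := Summit.BirchSwinnertonDyer.Rank1Residual.P2.shaAnOver_baseChange_eq_heegnerIndex_sq W N K Dt H ι P
    hGZ hKo hmod hK hHN hP hc0 hrK
  haveI : Finite (W.baseChange K).sha := hShaK
  obtain ⟨q', hq', hle⟩ := hKup
  have hqq : q' = 4 * ((AddSubgroup.zmultiples P).index : ℚ) ^ 2 /
      ((Dt.c : ℚ) ^ 2 * (Units.torsionOrder K : ℚ) ^ 2 * ((W.baseChange K).tamagawaProduct : ℚ)) := by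
    exact_mod_cast hq'.symm.trans hval
  set I : ℕ := (AddSubgroup.zmultiples P).index with hI_def
  have hw2 : Units.torsionOrder K = 2 :=
    Literature.NumberTheory.QuadraticFields.Quadratic.torsionOrder_eq_two_of_discr_lt_neg_four hK.1 hd4
  have hPinf : ¬ IsOfFinAddOrder P := by
    intro hfin
    have hLK := (lDerivEK_ne_zero_iff_not_isOfFinAddOrder W N K hGZ hK hHN ⟨Dt, H, ι, hP⟩).not
    obtain ⟨-, hLK'⟩ := Summit.BirchSwinnertonDyer.Rank1Residual.P2.leadingLCoeff_baseChange_eq_lDerivEK W K hmod hK.1 hrK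
    exact (hLK.mpr (not_not.mpr hfin)) hLK'
  have hheight := Summit.BirchSwinnertonDyer.Rank1Residual.P2.torsionOrder_sq_mul_canonicalHeight_eq_index_sq_mul_regulator
    (W.baseChange K) hrk P hPinf
  have htK : 0 < (W.baseChange K).torsionOrder := (W.baseChange K).torsionOrder_pos_holds
  have hI0 : I ≠ 0 := by
    intro hI
    rw [← hI_def, hI] at hheight
    have h0 : ((W.baseChange K).torsionOrder : ℝ) ^ 2 * P.canonicalHeight = 0 := by rw [hheight]; simp
    rcases mul_eq_zero.mp h0 with h' | h'
    · exact absurd ((pow_eq_zero_iff two_ne_zero).mp h') (by exact_mod_cast htK.ne')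
    · exact hPinf ((Affine.Point.canonicalHeight_eq_zero_iff_holds P).mp h')
  have hcK : 0 < (W.baseChange K).tamagawaProduct := (W.baseChange K).tamagawaProduct_pos_holds
  have hIQ : (I : ℚ) ≠ 0 := by exact_mod_cast hI0
  have hcQ : (Dt.c : ℚ) ≠ 0 := by exact_mod_cast hc0
  have hwQ : (Units.torsionOrder K : ℚ) ≠ 0 := by rw [hw2]; norm_num
  have hcKQ : ((W.baseChange K).tamagawaProduct : ℚ) ≠ 0 := by exact_mod_cast hcK.ne'
  have hsha : padicValNat 2 (Nat.card (AddCommGroup.primaryComponent (W.baseChange K).sha 2)) =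
      padicValNat 2 (W.baseChange K).shaOrder :=
    Literature.NumberTheory.EllipticCurves.padicValNat_card_addPrimaryComponent 2
  have hcval : padicValRat 2 (Dt.c : ℚ) = (padicValNat 2 Dt.c.natAbs : ℤ) := by
    rw [padicValRat.of_int]; rfl
  have h2val : padicValRat 2 (((2 : ℕ) : ℚ)) = 1 := by
    rw [padicValRat.of_nat, padicValNat_self]; rfl
  have h4val : padicValRat 2 (4 : ℚ) = 2 := by
    rw [show (4 : ℚ) = ((2 : ℕ) : ℚ) ^ 2 by norm_num, padicValRat.pow, h2val]; norm_num
  have hLHS : padicValRat 2 (4 * (I : ℚ) ^ 2 / ((Dt.c : ℚ) ^ 2 * (Units.torsionOrder K : ℚ) ^ 2 *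
      ((W.baseChange K).tamagawaProduct : ℚ))) =
      2 + 2 * (padicValNat 2 I : ℤ) - (2 * (padicValNat 2 Dt.c.natAbs : ℤ) + 2 * 1 +
        (padicValNat 2 (W.baseChange K).tamagawaProduct : ℤ)) := by
    rw [padicValRat.div (mul_ne_zero (by norm_num) (pow_ne_zero 2 hIQ))
        (mul_ne_zero (mul_ne_zero (pow_ne_zero 2 hcQ) (pow_ne_zero 2 hwQ)) hcKQ),
      padicValRat.mul (by norm_num) (pow_ne_zero 2 hIQ), padicValRat.mul (mul_ne_zero (pow_ne_zero 2 hcQ) (pow_ne_zero 2 hwQ)) hcKQ,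
      padicValRat.mul (pow_ne_zero 2 hcQ) (pow_ne_zero 2 hwQ), padicValRat.pow, padicValRat.pow, padicValRat.pow, h4val, hw2, hcval,
      h2val, padicValRat.of_nat, padicValRat.of_nat]
    push_cast
    ring
  rw [hqq, hLHS] at hle
  rw [hsha]
  linarith

/-- **The converse of B1′ (currency EQUIVALENCE).** For ONE `W/ℚ` with `r_an(W) = 1`, GIVEN the toric prints `hF` (Gross–Zagier, Kolyvagin,
modularity used): the `Ш_an`-currency `K`-side upper half `hKup` (the text of `stub_kolyvaginUpperOverKAtTwo` for `W`) implies the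
INDEX-currency bound on every Heegner frame of `W` with `d_K < −4` and `P` non-torsion (`KolyvaginBoundAtTwoOnFrames W`, unfolded): `P`
non-torsion gives `L'(E/K,1) ≠ 0`, hence `L(E^{(d_K)},1) ≠ 0` (`L'(E/K,1) = L'(E,1)·L(E^{(d_K)},1)`) and `r_an(E_K) = 1`; `E_K = W ⊗ K` keeps the
minimal model; apply `hKup` at `W' = E_K` and read Gross–Zagier backwards (`indexBound_two_of_upperOverK_baseChange`). With
`upperOverK_of_kolyvaginBoundOnFrames` the two currencies of U′ are EQUIVALENT for every `W` with `r_an = 1`, `2 ∣ N_W`.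
[cite: GrossZagier1986, Thm. I.6.3 and V.(2.2)] [cite: Kolyvagin1990, Thm. A (shape)] -/
theorem kolyvaginBoundOnFrames_of_upperOverK (hF : ToricPublishedInputs)
    (W : WeierstrassCurve ℚ) [W.IsElliptic] [W.IsGloballyMinimal] (hr : W.analyticRank = 1)
    (hKup : ∀ (N : ℕ) [NeZero N] (K : Type) [Field K] [NumberField K]
      (W' : WeierstrassCurve K) [W'.IsElliptic] [W'.IsGloballyMinimal],
      W.conductorNorm ℤ = N → IsImaginaryQuadratic K → SatisfiesHeegnerHypothesis N K →
      (W.quadraticTwist (NumberField.discr K : ℚ)).entireLFunction 1 ≠ 0 →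
      (∃ C : VariableChange K, C • W.baseChange K = W') →
      ∃ q' : ℚ, shaAnOver W' = (q' : ℂ) ∧ (padicValNat 2 W'.shaOrder : ℤ) ≤ padicValRat 2 q') :
    ∀ (N : ℕ) [NeZero N] (K : Type) [Field K] [NumberField K] (Dt : ModularParametrizationData W N)
      (H : HeegnerDatum N (NumberField.discr K)) (ι : K →+* ℂ) (P : (W.baseChange K).toAffine.Point),
      W.conductorNorm ℤ = N → IsImaginaryQuadratic K → SatisfiesHeegnerHypothesis N K → NumberField.discr K < -4 →
      WeierstrassCurve.Affine.Point.map ι.toRatAlgHom P = heegnerPointComplex Dt H → ¬ IsOfFinAddOrder P →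
      Finite (W.baseChange K).sha →
      (padicValNat 2 (Nat.card (AddCommGroup.primaryComponent (W.baseChange K).sha 2)) : ℤ) +
          (padicValNat 2 (W.baseChange K).tamagawaProduct : ℤ) ≤
        2 * (padicValNat 2 (AddSubgroup.zmultiples P).index : ℤ) - 2 * (padicValNat 2 Dt.c.natAbs : ℤ) := by
  intro N _ K _ _ Dt H ι P hN hK hHN hd4 hP hnt _
  obtain ⟨hGZ, hKo, -, hmod, -, -, -, -, -, -⟩ := hF
  subst hN
  have h2 : Module.finrank ℚ K = 2 := hK.1
  ------------------------------------------------------------------ `L(E^{(d_K)},1) ≠ 0` from `P` non-torsion, `r_an(E_K) = 1`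
  have hL0 : W.entireLFunction 1 = 0 := entireLFunction_one_eq_zero_of_analyticRank_eq_one hr
  have hLK : LDerivEK W K ≠ 0 :=
    (lDerivEK_ne_zero_iff_not_isOfFinAddOrder W (W.conductorNorm ℤ) K (hGZ _ W K) hK hHN ⟨Dt, H, ι, hP⟩).mpr hnt
  have hLt : (W.quadraticTwist (NumberField.discr K : ℚ)).entireLFunction 1 ≠ 0 := by
    intro h0
    apply hLK
    rw [lDerivEK_eq_deriv_mul W K hmod hL0, h0, mul_zero]
  have hD0 : (NumberField.discr K : ℚ) ≠ 0 := by exact_mod_cast NumberField.discr_ne_zero K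
  haveI hEt : (W.quadraticTwist (NumberField.discr K : ℚ)).IsElliptic := W.isElliptic_quadraticTwist hD0
  have hrd0 : (W.quadraticTwist (NumberField.discr K : ℚ)).analyticRank = 0 :=
    ((W.quadraticTwist (NumberField.discr K : ℚ)).analyticRank_eq_zero_iff_holds (hmod _)).mpr hLt
  have hrK : (W.baseChange K).analyticRank = 1 :=
    (Summit.BirchSwinnertonDyer.Rank1Residual.P2.analyticRank_baseChange_eq_one_iff W K hmod h2).mpr (Or.inl ⟨hr, hrd0⟩)
  ------------------------------------------------------------------ `hKup` on the minimal model `E_K`, Gross–Zagier backwards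
  haveI : (W.baseChange K).IsGloballyMinimal := W.isGloballyMinimal_baseChange_of_satisfiesHeegnerHypothesis K h2 hHN
  haveI : (W.baseChange K).IsElliptic := isElliptic_baseChange' W K
  have hKup₁ := hKup (W.conductorNorm ℤ) K (W.baseChange K) rfl hK hHN hLt ⟨1, one_smul _ _⟩
  exact indexBound_two_of_upperOverK_baseChange W K Dt H ι P (hGZ _ W K) (hKo _ W K) hmod hK hd4 hHN hP hrK hKup₁

end Summit.BirchSwinnertonDyer.BirchSwinnertonDyer.Theorems.PrintCf2.KsideFiniteTwo

end
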